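import Literature.Barriers.NavierStokesRegularity.NavierStokesInequalityArrangement
import HarnessLib

/-!
# Scheffer's block from planar profiles: the two halves of `NSIBlock_of_arrangement`

Barrier catalogue support file for `NavierStokesRegularity` (D-0021), the layer under
`NavierStokesInequalityArrangement`, decomposing its fact D
`Literature.Barriers.NavierStokesRegularity.NSIBlock_of_arrangement` ("a classical block from a
geometric arrangement": Ożański, arXiv:1709.00602v4, §4, Lemma 4.1, (4.21), Prop. 4.2; Scheffer,
Comm. Math. Phys. 101 (1985), Lemma 2.1 and Lemmas 3.1–3.3) along the seam printed in SCHEFFER's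
original, whose §2–§3 separate

* **Lemma 2.1 (pp. 51–55)** — the POINTWISE VERIFICATION: given planar data on the half-plane
  `P` — compact sets `C'ᵢ ⊆ Cᵢ ⊆ P`, directions `Sᵢ ∈ {1,-1}`, a slack `η > 0`, planar fields
  `vᵢ ∈ C_c^∞(P;ℝ²)` with `spt vᵢ ⊆ C'ᵢ` and `div(x₂vᵢ) = 0` ((2.3), (2.9)), and time-dependent
  profiles `qᵢ : P × J → [0,∞)` smooth, `qᵢ > |vᵢ|` on `spt vᵢ`, `qᵢ = 0` off `Cᵢ` ((2.3)–(2.5)),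
  satisfying on `C'ᵢ` the differential inequality (2.6)
  `∂ₜ(½qᵢ²) ≤ -η - Sᵢvᵢ·∇(½qᵢ² + p[S₁v₁,q₁,ₜ] + p[S₂v₂,q₂,ₜ])` and off `C'ᵢ` (2.7)–(2.8)
  `∂ₜ(½qᵢ²) ≤ 0`, `L(qᵢ,ₜ) ≥ 0` — the field `u = u[S₁v₁,q₁,ₜ] + u[S₂v₂,q₂,ₜ]` ((2.10)) with its
  pressure `p = p*[S₁v₁,q₁,ₜ] + p*[S₂v₂,q₂,ₜ]` ((2.14)–(2.15)) satisfies the Navier–Stokes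
  inequality pointwise for all `0 < ν < ν₀` ((2.18), (2.27): on `R(C'₁ ∪ C'₂)` the slack `η`
  absorbs `ν u·Δu` by compactness, off it `u·Δu = (S₁q₁L(q₁) + S₂q₂L(q₂))… ≥ 0` by (2.19)–(2.22)
  and `u·∇(½|u|² + p) = 0` by (2.26));
* **Lemmas 3.1–3.3 (pp. 57–66)** — the CONSTRUCTION of such profiles from the hypotheses
  (3.1)–(3.7) (= the geometric arrangement): the cut-offs `gᵢ` and `h₁, h₂, δ` of Lemma 3.1
  ((3.8)–(3.15)), the three-phase switching scheme `q^z_i`, `z = 1,2,3`, of Lemma 3.2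
  ((3.34)–(3.41)) with the uniform-continuity choice (3.56) of the period `4d = T/N`.

Ożański's Proposition 4.2 fuses the two (his `u(x,t) = u[a₁ᵏ(t)v₁, qᵏ₁,ₜ] + u[a₂ᵏ(t)v₂, qᵏ₂,ₜ]`,
(4.17), with SMOOTH oscillatory processes `aᵢᵏ ∈ C^∞(ℝ;[-1,1])`, Theorem 4.3, so that one field
is smooth on the whole slab `ℝ³ × (-η, T+η)` — the form the tree's `IsNSIBlock` asks for —
where Scheffer glues `3N` smooth pieces by his Lemma 2.2); §4.2 ("The proof of the claims of
the proposition", Cases 1 and 2) is exactly Scheffer's Lemma 2.1 with time-dependent directions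
`aᵢ(t) ∈ [-1,1]` in place of `Sᵢ`, and §4.1, §4.3, Lemma 4.1 and Appendix A are the
construction. Accordingly this file vendors

* `IsNSIProfileData` — Scheffer's hypotheses (2.1)–(2.9) for smooth time-dependent directions
  (the list of properties of `aᵢᵏ, qᵏᵢ,ₜ` established in Ożański §4.1: (4.19), smoothness,
  `qᵏᵢ,₀ = fᵢ`, and the inequalities of §4.2), together with the gain inequality at `t = T`
  (Ożański (4.11) with Prop. 4.2 (ii); Scheffer (3.14), (3.40));
* `profileField` — the field `u(t) = u[a₁(t)v₁, Q₁(t)] + u[a₂(t)v₂, Q₂(t)]` (Ożański (4.17);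
  Scheffer (2.10));
* fact D-I `NSIBlock_of_profiles` (Scheffer Lemma 2.1; Ożański §4.2 with (4.21)): arrangement +
  profile data ⇒ `profileField` is a classical block `IsNSIBlock` for some `ν₀ > 0`;
* fact D-II `NSIProfiles_of_arrangement` (Scheffer Lemmas 3.1–3.2; Ożański Lemma 4.1, §4.1,
  Theorem 4.3, Lemma A.1): every arrangement carries profile data;
* PROVED: `nsiBlock_of_arrangement_of_profiles : D-I → D-II → NSIBlock_of_arrangement`.

## Rendering

Dictionary as in `NavierStokesInequalityArrangement` (axis `x 2`, plane point `q = (r,z)`,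
`R⁻¹ = meridian`, `u[v,f] = swirlField v f`, `p[v,f] = planePressure v f`, `L = opL`, planar
partials `derivR`, `derivZ`). Scheffer's `J ⊇ [a,b]` is `Ioo (-η) (T+η) ⊇ [0,T]`, his `Cᵢ` is
`closure Uᵢ`, his `C'ᵢ` is `Cᵢ` below (`IsClosed`, `tsupport vᵢ ⊆ Cᵢ ⊆ Uᵢ`; in the construction
`Cᵢ = {gᵢ = 1}` for Scheffer's cut-off `gᵢ` of (3.16), Ożański's `{φᵢ = 1}`), his slack `η` is
`δ` below (Ożański's `δ` of Lemma 4.1, after the absorption (4.25)), his `Sᵢ` is `aᵢ(t)`. The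
inequalities are imposed for `t ∈ [0,T]` (where `IsNSIBlock` needs them), smoothness and the sign
and support conditions on the open interval. `∂ₜ(qᵢ²)` is `deriv (fun s => Qᵢ s q ^ 2) t`; the
transport term `Sᵢvᵢ·∇(qᵢ² + 2p[·] + 2p[·])` is written with the planar potential
`profilePotential` and the Fréchet partials. Scheffer's (2.5) `qᵢ > |vᵢ|` on `spt vᵢ` is imposed
on `Uᵢ` (Ożański (4.19): `qᵏᵢ,ₜ > |vᵢ| ≥ 0` in `Uᵢ`), which also gives `supp u(t) = G` exactly.

Deliberately NOT here: the proofs of D-I (the calculus of `u[v,f]`, Ożański Lemma 3.1, and of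
its pressure, Lemma 3.2, additivity and axisymmetry being the tree's
`NormalisedPressureDisjointAdd`, `NavierStokesInequalityPressureSymmetry`) and of D-II.

## References

* V. Scheffer, *A solution to the Navier–Stokes inequality with an internal singularity*,
  Comm. Math. Phys. 101 (1985), 47–85: Lemma 2.1 ((2.1)–(2.27), pp. 51–55), Lemma 2.2,
  Lemmas 3.1–3.3 ((3.1)–(3.41), (3.56)–(3.58), pp. 57–66). [`Scheffer1985`]
* W. S. Ożański, arXiv:1709.00602v4, §4: Lemma 4.1, (4.17)–(4.22), Prop. 4.2, §4.2 (Cases 1–2),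
  Theorem 4.3, Appendix A. [`Ozanski2017NSISingular`] (The held plain-text rendering numbers
  Lemma 4.1, Prop. 4.2, Thm. 4.3 as Lemma 8, Prop. 9, Thm. 10.)
-/

noncomputable section

open MeasureTheory Set Function Filter Topology TopologicalSpace WithLp Metric
open scoped ENNReal InnerProductSpace RealInnerProductSpace ContDiff

namespace Literature.Barriers.NavierStokesRegularity

open Literature.Analysis.FluidPDE

/-- Local notation for physical space `ℝ³ = EuclideanSpace ℝ (Fin 3)`. -/
local notation "ℝ³" => EuclideanSpace ℝ (Fin 3)

/-! ### The field and the planar potential -/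

/-- **The field of the block**, `u(x,t) = u[a₁(t)v₁, Q₁(t)](x) + u[a₂(t)v₂, Q₂(t)](x)` (Ożański
(4.17) with the oscillatory processes `aᵢ = aᵢᵏ` and profiles `Qᵢ(t) = qᵏᵢ,ₜ`; Scheffer (2.10):
`uⁱ(x,t) = u[Sᵢvᵢ, qᵢ,ₜ](x)`, `u = u¹ + u²`), time first.
[cite: Ozanski2017NSISingular, §4.1 (4.17)] [cite: Scheffer1985, Lemma 2.1 (2.10)] -/
def profileField (v₁ v₂ : ℝ × ℝ → ℝ × ℝ) (a₁ a₂ : ℝ → ℝ) (Q₁ Q₂ : ℝ → ℝ × ℝ → ℝ) (t : ℝ)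
    (x : ℝ³) : ℝ³ :=
  swirlField (a₁ t • v₁) (Q₁ t) x + swirlField (a₂ t • v₂) (Q₂ t) x

/-- Unfolding `profileField`. [folklore] -/
theorem profileField_apply (v₁ v₂ : ℝ × ℝ → ℝ × ℝ) (a₁ a₂ : ℝ → ℝ) (Q₁ Q₂ : ℝ → ℝ × ℝ → ℝ)
    (t : ℝ) (x : ℝ³) :
    profileField v₁ v₂ a₁ a₂ Q₁ Q₂ t x =
      swirlField (a₁ t • v₁) (Q₁ t) x + swirlField (a₂ t • v₂) (Q₂ t) x := rfl

/-- **The planar potential** `Φᵢ(t) = Qᵢ(t)² + 2(p[a₁(t)v₁, Q₁(t)] + p[a₂(t)v₂, Q₂(t)])` whose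
planar gradient, paired with `aᵢ(t)vᵢ`, is the transport term of the Navier–Stokes inequality
on the meridian half-plane (Ożański (4.26): `-(a₁ᵏv₁ + a₂ᵏv₂)·∇(q₁² + q₂² + 2p[a₁ᵏv₁,q₁] +
2p[a₂ᵏv₂,q₂])`; Scheffer (2.6), (2.15)–(2.17): `Sᵢvᵢ·∇(½qᵢ² + p[S₁v₁,q₁,ₜ] + p[S₂v₂,q₂,ₜ])`,
`p(x₁,x₂,0,t) = (p¹ + p²)`). The argument `Q` is the profile whose square enters (`Q₁` or `Q₂`;
the other square has vanishing gradient where `vᵢ ≠ 0`).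
[cite: Scheffer1985, Lemma 2.1 (2.6) and (2.15)] -/
def profilePotential (v₁ v₂ : ℝ × ℝ → ℝ × ℝ) (a₁ a₂ : ℝ → ℝ) (Q₁ Q₂ Q : ℝ → ℝ × ℝ → ℝ) (t : ℝ)
    (q : ℝ × ℝ) : ℝ :=
  Q t q ^ 2 + 2 * (planePressure (a₁ t • v₁) (Q₁ t) q + planePressure (a₂ t • v₂) (Q₂ t) q)

/-! ### Profile data (Scheffer 1985, Lemma 2.1, hypotheses (2.1)–(2.9)) -/

/-- **Profile data for Scheffer's block** — the hypotheses (2.1)–(2.9) of Scheffer's Lemma 2.1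
with smooth time-dependent directions `aᵢ(t) ∈ [-1,1]` (Ożański's oscillatory processes `aᵢᵏ`,
Theorem 4.3) in place of the constant signs `Sᵢ ∈ {1,-1}`, i.e. the list of properties of
`(aᵢᵏ, qᵏᵢ,ₜ)` established in Ożański §4.1–4.2 for the field (4.17), plus the gain at `t = T`
(Ożański (4.11) with Prop. 4.2 (ii); Scheffer (3.14), (3.40)). Given the planar sets and fields
`U₁, U₂, v₁, v₂, f₁, f₂` and the constants `T, τ, z` of a geometric arrangement: a margin `η > 0`
(`J = (-η, T+η)`, Scheffer (2.1)), a slack `δ > 0` (Scheffer's `η`, Ożański's `δ`), closed sets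
`Cᵢ` with `supp vᵢ ⊆ Cᵢ ⊆ Uᵢ` (Scheffer's `C'ᵢ`, (2.2)–(2.3)), directions `aᵢ ∈ C^∞(ℝ;[-1,1])`
and profiles `Qᵢ : J × ℝ² → [0,∞)` jointly smooth ((2.3)), vanishing off `Ūᵢ` ((2.4)), with
`Qᵢ(t) > |vᵢ|` in `Uᵢ` ((2.5); Ożański (4.19)) and `Qᵢ(0) = fᵢ` (Ożański: `qᵏᵢ,₀ = fᵢ`), such
that for `t ∈ [0,T]`: on `Cᵢ` the differential inequality with slack
`∂ₜ(Qᵢ²) ≤ -δ - aᵢ(t)vᵢ·∇(Qᵢ² + 2p[a₁v₁,Q₁] + 2p[a₂v₂,Q₂])` ((2.6); Ożański (4.22) with (4.25)),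
off `Cᵢ` `∂ₜ(Qᵢ²) ≤ 0` ((2.7); Ożański Case 1: `= -2δφᵢ`) and `Qᵢ L(Qᵢ) ≥ 0` in `P` ((2.8);
Ożański (3.24)); and the gain `Q₁(T) + Q₂(T) ≥ τ⁻¹(Q₁(0) + Q₂(0)) ∘ R⁻¹` along `Γ(x) = τx + z` on
`G = R(Ū₁ ∪ Ū₂)` (from (4.11) and Prop. 4.2 (ii)). The divergence condition (2.9) and the
regularity of `vᵢ` are part of the arrangement (`IsNSIStructure`) and not repeated.
[cite: Scheffer1985, Lemma 2.1 (2.1)–(2.9)] [cite: Ozanski2017NSISingular, §4.1 (4.17)–(4.19) and §4.2] -/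
structure IsNSIProfileData (U₁ U₂ : Set (ℝ × ℝ)) (v₁ v₂ : ℝ × ℝ → ℝ × ℝ) (f₁ f₂ : ℝ × ℝ → ℝ)
    (T τ : ℝ) (z : ℝ³) (η δ : ℝ) (C₁ C₂ : Set (ℝ × ℝ)) (a₁ a₂ : ℝ → ℝ)
    (Q₁ Q₂ : ℝ → ℝ × ℝ → ℝ) : Prop where
  /-- The time margin is positive (`J = (-η, T + η) ⊇ [0,T]`, Scheffer (2.1)). -/
  η_pos : 0 < η
  /-- The slack is positive (Scheffer (2.3): `η > 0`; Ożański Lemma 4.1: `δ > 0`). -/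
  δ_pos : 0 < δ
  /-- The directions are smooth … -/
  a₁_smooth : ContDiff ℝ ∞ a₁
  /-- … -/
  a₂_smooth : ContDiff ℝ ∞ a₂
  /-- … and bounded by one (`aᵢ ∈ C^∞(ℝ;[-1,1])`, Ożański Theorem 4.3). -/
  abs_a₁_le : ∀ t, |a₁ t| ≤ 1
  /-- `|a₂| ≤ 1`. -/
  abs_a₂_le : ∀ t, |a₂ t| ≤ 1
  /-- `C₁` is closed (Scheffer (2.2): compact), -/
  isClosed₁ : IsClosed C₁
  /-- `C₂` is closed, -/
  isClosed₂ : IsClosed C₂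
  /-- `C₁ ⊆ U₁` (Scheffer (2.2): `C'ᵢ ⊆ Cᵢ`), -/
  subset₁ : C₁ ⊆ U₁
  /-- `C₂ ⊆ U₂`, -/
  subset₂ : C₂ ⊆ U₂
  /-- `supp v₁ ⊆ C₁` (Scheffer (2.3)), -/
  tsupport_v₁ : tsupport v₁ ⊆ C₁
  /-- `supp v₂ ⊆ C₂`. -/
  tsupport_v₂ : tsupport v₂ ⊆ C₂
  /-- `Q₁` is jointly smooth on `J × ℝ²` (Scheffer (2.3): `qᵢ : P × J → ℝ` is `C^∞`). -/
  Q₁_smooth : ContDiffOn ℝ ∞ (uncurry Q₁) (Ioo (-η) (T + η) ×ˢ univ)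
  /-- `Q₂` is jointly smooth on `J × ℝ²`. -/
  Q₂_smooth : ContDiffOn ℝ ∞ (uncurry Q₂) (Ioo (-η) (T + η) ×ˢ univ)
  /-- `Q₁ ≥ 0` (Scheffer (2.3)). -/
  Q₁_nonneg : ∀ t ∈ Ioo (-η) (T + η), ∀ q, 0 ≤ Q₁ t q
  /-- `Q₂ ≥ 0`. -/
  Q₂_nonneg : ∀ t ∈ Ioo (-η) (T + η), ∀ q, 0 ≤ Q₂ t q
  /-- `Q₁(t) = 0` off `Ū₁` (Scheffer (2.4)). -/
  Q₁_eq_zero : ∀ t ∈ Ioo (-η) (T + η), ∀ q ∉ closure U₁, Q₁ t q = 0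
  /-- `Q₂(t) = 0` off `Ū₂`. -/
  Q₂_eq_zero : ∀ t ∈ Ioo (-η) (T + η), ∀ q ∉ closure U₂, Q₂ t q = 0
  /-- `Q₁(t) > |v₁|` in `U₁` (Scheffer (2.5); Ożański (4.19)). -/
  sq_lt₁ : ∀ t ∈ Ioo (-η) (T + η), ∀ q ∈ U₁, (v₁ q).1 ^ 2 + (v₁ q).2 ^ 2 < Q₁ t q ^ 2
  /-- `Q₂(t) > |v₂|` in `U₂`. -/
  sq_lt₂ : ∀ t ∈ Ioo (-η) (T + η), ∀ q ∈ U₂, (v₂ q).1 ^ 2 + (v₂ q).2 ^ 2 < Q₂ t q ^ 2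
  /-- `Q₁(0) = f₁` (Ożański §4.2: `qᵏ₁,₀ = f₁`). -/
  initial₁ : ∀ q, Q₁ 0 q = f₁ q
  /-- `Q₂(0) = f₂`. -/
  initial₂ : ∀ q, Q₂ 0 q = f₂ q
  /-- On `C₁`, `t ∈ [0,T]`: `∂ₜ(Q₁²) ≤ -δ - a₁v₁·∇(Q₁² + 2p[a₁v₁,Q₁] + 2p[a₂v₂,Q₂])`
  (Scheffer (2.6); Ożański §4.2, Case 2). -/
  inner₁ : ∀ t ∈ Icc (0 : ℝ) T, ∀ q ∈ C₁, deriv (fun s => Q₁ s q ^ 2) t ≤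
    -δ - (a₁ t * (v₁ q).1 * derivR (profilePotential v₁ v₂ a₁ a₂ Q₁ Q₂ Q₁ t) q +
      a₁ t * (v₁ q).2 * derivZ (profilePotential v₁ v₂ a₁ a₂ Q₁ Q₂ Q₁ t) q)
  /-- On `C₂`, `t ∈ [0,T]`: `∂ₜ(Q₂²) ≤ -δ - a₂v₂·∇(Q₂² + 2p[a₁v₁,Q₁] + 2p[a₂v₂,Q₂])`. -/
  inner₂ : ∀ t ∈ Icc (0 : ℝ) T, ∀ q ∈ C₂, deriv (fun s => Q₂ s q ^ 2) t ≤
    -δ - (a₂ t * (v₂ q).1 * derivR (profilePotential v₁ v₂ a₁ a₂ Q₁ Q₂ Q₂ t) q +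
      a₂ t * (v₂ q).2 * derivZ (profilePotential v₁ v₂ a₁ a₂ Q₁ Q₂ Q₂ t) q)
  /-- Off `C₁`, `t ∈ [0,T]`: `∂ₜ(Q₁²) ≤ 0` (Scheffer (2.7); Ożański §4.2, Case 1). -/
  outer₁ : ∀ t ∈ Icc (0 : ℝ) T, ∀ q ∉ C₁, deriv (fun s => Q₁ s q ^ 2) t ≤ 0
  /-- Off `C₂`, `t ∈ [0,T]`: `∂ₜ(Q₂²) ≤ 0`. -/
  outer₂ : ∀ t ∈ Icc (0 : ℝ) T, ∀ q ∉ C₂, deriv (fun s => Q₂ s q ^ 2) t ≤ 0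
  /-- Off `C₁` in `P`, `t ∈ [0,T]`: `Q₁ L(Q₁) ≥ 0` (Scheffer (2.8): `L(qᵢ,ₜ) ≥ 0`; Ożański
  (3.24): `u·Δu = fLf ≥ 0`). -/
  opL₁ : ∀ t ∈ Icc (0 : ℝ) T, ∀ q ∉ C₁, 0 < q.1 → 0 ≤ Q₁ t q * opL (Q₁ t) q
  /-- Off `C₂` in `P`, `t ∈ [0,T]`: `Q₂ L(Q₂) ≥ 0`. -/
  opL₂ : ∀ t ∈ Icc (0 : ℝ) T, ∀ q ∉ C₂, 0 < q.1 → 0 ≤ Q₂ t q * opL (Q₂ t) q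
  /-- The gain along `Γ(x) = τx + z` on `G = R(Ū₁ ∪ Ū₂)`:
  `(Q₁(T) + Q₂(T))(R⁻¹(Γx)) ≥ τ⁻¹ (Q₁(0) + Q₂(0))(R⁻¹x)` (Ożański (4.11) with Prop. 4.2 (ii) and
  p. 16; Scheffer (3.14), (3.40)). -/
  gain : ∀ x ∈ revolve (closure U₁ ∪ closure U₂),
    τ⁻¹ * (Q₁ 0 (meridian x) + Q₂ 0 (meridian x)) ≤
      Q₁ T (meridian (τ • x + z)) + Q₂ T (meridian (τ • x + z))

namespace IsNSIProfileData

variable {U₁ U₂ : Set (ℝ × ℝ)} {v₁ v₂ : ℝ × ℝ → ℝ × ℝ} {f₁ f₂ : ℝ × ℝ → ℝ} {T τ : ℝ} {z : ℝ³}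
  {η δ : ℝ} {C₁ C₂ : Set (ℝ × ℝ)} {a₁ a₂ : ℝ → ℝ} {Q₁ Q₂ : ℝ → ℝ × ℝ → ℝ}

/-- `[0,T] ⊆ J`. [folklore] -/
theorem Icc_subset (h : IsNSIProfileData U₁ U₂ v₁ v₂ f₁ f₂ T τ z η δ C₁ C₂ a₁ a₂ Q₁ Q₂) :
    Icc (0 : ℝ) T ⊆ Ioo (-η) (T + η) := fun _ ht =>
  ⟨by linarith [h.η_pos, ht.1], by linarith [h.η_pos, ht.2]⟩

/-- `Q₁(t) > 0` in `U₁` for `t ∈ J` (from `Q₁ > |v₁| ≥ 0`). [cite: Ozanski2017NSISingular, §4.1 (4.19)] -/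
theorem Q₁_pos (h : IsNSIProfileData U₁ U₂ v₁ v₂ f₁ f₂ T τ z η δ C₁ C₂ a₁ a₂ Q₁ Q₂) {t : ℝ}
    (ht : t ∈ Ioo (-η) (T + η)) {q : ℝ × ℝ} (hq : q ∈ U₁) : 0 < Q₁ t q := by
  have h1 := h.sq_lt₁ t ht q hq
  have h2 := h.Q₁_nonneg t ht q
  rcases h2.lt_or_eq with h3 | h3
  · exact h3
  · rw [← h3] at h1
    nlinarith [sq_nonneg (v₁ q).1, sq_nonneg (v₁ q).2]

/-- `Q₂(t) > 0` in `U₂` for `t ∈ J`. [cite: Ozanski2017NSISingular, §4.1 (4.19)] -/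
theorem Q₂_pos (h : IsNSIProfileData U₁ U₂ v₁ v₂ f₁ f₂ T τ z η δ C₁ C₂ a₁ a₂ Q₁ Q₂) {t : ℝ}
    (ht : t ∈ Ioo (-η) (T + η)) {q : ℝ × ℝ} (hq : q ∈ U₂) : 0 < Q₂ t q := by
  have h1 := h.sq_lt₂ t ht q hq
  have h2 := h.Q₂_nonneg t ht q
  rcases h2.lt_or_eq with h3 | h3
  · exact h3
  · rw [← h3] at h1
    nlinarith [sq_nonneg (v₂ q).1, sq_nonneg (v₂ q).2]

/-- `supp Q₁(t) = Ū₁` for `t ∈ J` (Ożański Prop. 4.2 (i): `supp u(t) = G`).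
[cite: Ozanski2017NSISingular, Prop. 4.2 (i)] -/
theorem tsupport_Q₁ (h : IsNSIProfileData U₁ U₂ v₁ v₂ f₁ f₂ T τ z η δ C₁ C₂ a₁ a₂ Q₁ Q₂)
    {t : ℝ} (ht : t ∈ Ioo (-η) (T + η)) : tsupport (Q₁ t) = closure U₁ := by
  apply Subset.antisymm
  · refine closure_minimal (fun q hq => ?_) isClosed_closure
    by_contra hq'
    exact hq (h.Q₁_eq_zero t ht q hq')
  · exact closure_mono fun q hq => Function.mem_support.2 (h.Q₁_pos ht hq).ne'

/-- `supp Q₂(t) = Ū₂` for `t ∈ J`. [cite: Ozanski2017NSISingular, Prop. 4.2 (i)] -/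
theorem tsupport_Q₂ (h : IsNSIProfileData U₁ U₂ v₁ v₂ f₁ f₂ T τ z η δ C₁ C₂ a₁ a₂ Q₁ Q₂)
    {t : ℝ} (ht : t ∈ Ioo (-η) (T + η)) : tsupport (Q₂ t) = closure U₂ := by
  apply Subset.antisymm
  · refine closure_minimal (fun q hq => ?_) isClosed_closure
    by_contra hq'
    exact hq (h.Q₂_eq_zero t ht q hq')
  · exact closure_mono fun q hq => Function.mem_support.2 (h.Q₂_pos ht hq).ne'

end IsNSIProfileData

/-! ### The two named facts and the assembly of fact D -/

/-- **Fact D-I — a block from profile data** (Scheffer 1985, Lemma 2.1, in the smooth-direction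
form of Ożański 2017, §4.2 with the choice (4.21) of `ν₀`). For a geometric arrangement and
profile data `(η, δ, Cᵢ, aᵢ, Qᵢ)` adapted to it, the field
`u(t) = u[a₁(t)v₁, Q₁(t)] + u[a₂(t)v₂, Q₂(t)]` is, for some `ν₀ > 0`, a classical block
`IsNSIBlock T ν₀ τ z G u`, `G = R(Ū₁ ∪ Ū₂)`: `u ∈ C^∞(ℝ³ × (-η,T+η))`, `div u(t) = 0` and
`supp u(t) = G` (Ożański Lemma 3.1 (i), Prop. 4.2 (i); Scheffer (2.12)), the pointwise
Navier–Stokes inequality for all `ν ∈ [0,ν₀]` with the pressure `p̃[u(t)] = p*[a₁v₁,Q₁] +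
p*[a₂v₂,Q₂]` (Scheffer (2.15)–(2.27): on `R(C₁ ∪ C₂)` the slack absorbs `2ν u·Δu`, (2.18),
`ν₀` small by compactness; off it `u·∇(|u|² + 2p) = 0`, (2.26), and `u·Δu = Σ QᵢL(Qᵢ) ∘ R⁻¹ ≥ 0`,
(2.19)–(2.22); Ożański §4.2 Cases 1–2 with (3.24)–(3.25)), the gain (2.2) from the profile
gain and `|u[v,f]| = f` ((3.11)), and `u(·,0) ≢ 0` from `U₁ ≠ ∅`.
[cite: Scheffer1985, Lemma 2.1] [cite: Ozanski2017NSISingular, §4.2 and (4.21)] -/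
def NSIBlock_of_profiles : Prop :=
  ∀ (U₁ U₂ : Set (ℝ × ℝ)) (v₁ : ℝ × ℝ → ℝ × ℝ) (f₁ φ₁ : ℝ × ℝ → ℝ) (v₂ : ℝ × ℝ → ℝ × ℝ)
    (f₂ φ₂ : ℝ × ℝ → ℝ) (T τ : ℝ) (z : ℝ³) (η δ : ℝ) (C₁ C₂ : Set (ℝ × ℝ)) (a₁ a₂ : ℝ → ℝ)
    (Q₁ Q₂ : ℝ → ℝ × ℝ → ℝ),
    IsNSIArrangement U₁ U₂ v₁ f₁ φ₁ v₂ f₂ φ₂ T τ z →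
    IsNSIProfileData U₁ U₂ v₁ v₂ f₁ f₂ T τ z η δ C₁ C₂ a₁ a₂ Q₁ Q₂ →
    ∃ ν₀ : ℝ, IsNSIBlock T ν₀ τ z (revolve (closure U₁ ∪ closure U₂))
      (profileField v₁ v₂ a₁ a₂ Q₁ Q₂)

/-- **Fact D-II — profile data from an arrangement** (Scheffer 1985, Lemmas 3.1–3.2; Ożański
2017, Lemma 4.1, §4.1 and Theorem 4.3 with Appendix A). Every geometric arrangement carries
profile data: Scheffer's cut-offs `gᵢ` and `h₁, h₂, δ` of Lemma 3.1 ((3.8)–(3.15): `hᵢ` smooth on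
`P × (-δ, T+δ)`, `hᵢ > |vᵢ|` on `spt gᵢ`, `hᵢ = fᵢ` off `spt gᵢ`, `h²₁ = f₁² - 2tδg₁`,
`h²₂ = f₂² - 2tδg₂ - ∫₀ᵗ v₂·∇(p[v₁,h₁,ᵣ] - p[0,h₁,ᵣ]) dr`, the gain (3.14) and `L(hᵢ,ₜ) ≥ 0` where
`gᵢ < 1`, (3.15)) — Ożański's Lemma 4.1 with (4.11) — followed by the switching construction:
Ożański's `qᵏᵢ,ₜ` of (4.16) driven by the smooth oscillatory processes `aᵢᵏ` of Theorem 4.3,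
which for `k` large satisfy (4.18)–(4.19), (4.22) and, by the uniform convergence
`qᵏ → h` with derivatives and the continuity of `f ↦ ∇p[v,f]` (Lemma A.1), the inequalities of
§4.2 (Scheffer: the scheme `q^z_i` of Lemma 3.2, (3.34)–(3.41), with the uniform-continuity
choice (3.56) of the period). The directions are `aᵢ = aᵢᵏ`, the slack is Ożański's `δ`, and
`Cᵢ = {gᵢ = 1}`.
[cite: Scheffer1985, Lemmas 3.1–3.2] [cite: Ozanski2017NSISingular, Lemma 4.1, §4.1 and Theorem 4.3] -/
def NSIProfiles_of_arrangement : Prop :=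
  ∀ (U₁ U₂ : Set (ℝ × ℝ)) (v₁ : ℝ × ℝ → ℝ × ℝ) (f₁ φ₁ : ℝ × ℝ → ℝ) (v₂ : ℝ × ℝ → ℝ × ℝ)
    (f₂ φ₂ : ℝ × ℝ → ℝ) (T τ : ℝ) (z : ℝ³), IsNSIArrangement U₁ U₂ v₁ f₁ φ₁ v₂ f₂ φ₂ T τ z →
    ∃ (η δ : ℝ) (C₁ C₂ : Set (ℝ × ℝ)) (a₁ a₂ : ℝ → ℝ) (Q₁ Q₂ : ℝ → ℝ × ℝ → ℝ),
      IsNSIProfileData U₁ U₂ v₁ v₂ f₁ f₂ T τ z η δ C₁ C₂ a₁ a₂ Q₁ Q₂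

/-- **Assembly (proved): fact D from D-I and D-II** (Scheffer 1985, Lemma 3.3: "there exists
`ν₀ > 0` such that … is P-admissible", obtained from Lemmas 3.1, 3.2 and 2.1; Ożański 2017,
§4.1: "we will show that … (4.17) is a solution to Proposition 4.2 for sufficiently large `k`").
[cite: Scheffer1985, Lemma 3.3] -/
theorem nsiBlock_of_arrangement_of_profiles (hI : NSIBlock_of_profiles)
    (hII : NSIProfiles_of_arrangement) : NSIBlock_of_arrangement := by
  intro U₁ U₂ v₁ f₁ φ₁ v₂ f₂ φ₂ T τ z h
  obtain ⟨η, δ, C₁, C₂, a₁, a₂, Q₁, Q₂, hP⟩ := hII U₁ U₂ v₁ f₁ φ₁ v₂ f₂ φ₂ T τ z h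
  obtain ⟨ν₀, hB⟩ := hI U₁ U₂ v₁ f₁ φ₁ v₂ f₂ φ₂ T τ z η δ C₁ C₂ a₁ a₂ Q₁ Q₂ h hP
  exact ⟨ν₀, _, hB⟩

end Literature.Barriers.NavierStokesRegularity
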